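import Summits.HodgeConjecture.CorCM.MultiFieldWeilNonIsomorphicDecics
import HarnessLib

/-!
# MULTI-FIELD WEIL ENGINE — THREE FIELDS OF DEGREES `6, 6, 10` AND `6, 10, 10` SHARING `k`: two `(1,2)`-threefolds over non-isomorphic sextics with one
# `(2,3)`-fivefold, and one `(1,2)`-threefold with two `(2,3)`-fivefolds over non-isomorphic decics — every product of copies, given ONLY Markman's two theorems

Cell `pub-hodgecm2` (COR-CM), seat b30 gen 32 (2026-08-24); count-neutral own lane MULTI-FIELD WEIL ENGINE (stem `MultiFieldWeil*`), sequel of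
`CorCM/MultiFieldWeilNonIsomorphicDecics.lean` (§3: the `6, 6, 10, 10` case) using the same two field lemmas: gen 31's `finrank_adjoin_pair_of_isEmpty_ringHom` (two relative
cubics with `Hom = ∅`, degree `18`) and `finrank_adjoin_pair_of_isEmpty_ringHom_five` (two relative quintics with `Hom = ∅`, degree `50`), fed into G2b's
`hodgeConjectureFor_biproduct_comp_of_sexticsDecics_of_finrank` (a degree class with ONE member needs nothing).  Theorems only; no definition, no named fact, no `sorry`.
HONEST FRAMING: conditional on the two displayed Markman binders only; `HC_CM` is NOT proved and not asserted.  (One sextic + one decic, no hypothesis at all: gen 27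
`CorCM/SexticDecicWeilHodgeOfMarkman.lean`; two + two: `…NonIsomorphicDecics` §3.)

* **`hodgeConjectureFor_biproduct_comp_of_two_sextics_one_decic_of_isEmpty`** — `E`, `T₀, T₁` over NON-ISOMORPHIC sextics `K₀, K₁ ∋ k`, `F` over a decic `K₂ ∋ k`
  (`(2,3)`): HC for every `E^a × T₀^b × T₁^c × F^d`, mod Markman 4 + 6.
* **`hodgeConjectureFor_biproduct_comp_of_one_sextic_two_decics_of_isEmpty`** — `E`, `T` over a sextic `K₀ ∋ k`, `F₀, F₁` over NON-ISOMORPHIC decics `K₁, K₂ ∋ k`: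
  HC for every `E^a × T^b × F₀^c × F₁^d`, mod Markman 4 + 6.

[cite: Markman2025SurveySecant, Thm. 1.2] [cite: Markman2025SecantWeil, Thm 1.5.1] [cite: Lang2002, VI §1 Thm. 1.1, Cor. 1.6 and V §2 Thm. 2.8]

## References
* [Markman2025SurveySecant] E. Markman, arXiv:2509.23403, Thm. 1.2.  [Markman2025SecantWeil] E. Markman, Thm 1.5.1.  [Lang2002] S. Lang, *Algebra*, GTM 211, VI §1.
-/

noncomputable section

open CategoryTheory CategoryTheory.Limits NumberField IntermediateField

namespace Summit.HodgeConjecture.CorCM.MultiFieldWeil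

open Finset
open Literature.AlgebraicGeometry Literature.AlgebraicGeometry.Motives Literature.AlgebraicGeometry.HodgeTheory
open Literature.AlgebraicGeometry.ComplexMultiplication (IsCMTypeRealisation)
open Literature.AlgebraicTopology.SingularHomology
open Literature.NumberTheory.ComplexMultiplication

open scoped Classical

variable {I : Type} {Kf : I → Type} [∀ i, Field (Kf i)] [∀ i, NumberField (Kf i)] [∀ i, IsCMField (Kf i)]
  {i₀ : I} {is : Fin 3 → I} {τ : Kf i₀ →+* ℂ}
  {A : Fin (3 + 1) → AbelianVariety ℂ} {Φ : ∀ j : Fin (3 + 1), CMType (Kf (mfSlots i₀ is j))}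
  {ι : ∀ j, 𝓞 (Kf (mfSlots i₀ is j)) →+* End (A j)}
  {θ : ∀ j, Kf (mfSlots i₀ is j) →+* Module.End ℂ (complexBetti (A j).X 1)}

/-- **TWO `(1,2)`-THREEFOLDS OVER NON-ISOMORPHIC SEXTICS AND ONE `(2,3)`-FIVEFOLD, ALL SHARING `k` — given ONLY Markman's two theorems.**  `E = A 0 ⊨ (k; {τ})`;
`K_0, K_1` SEXTIC with `Hom(K_1, K_0) = ∅`, `K_2` DECIC (degrees `2 · (3, 3, 5)_m`, type counts `(1, 1, 2)_m` over `τ`).  Then the Hodge conjecture holds for EVERY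
product of copies `⨁_j A (κ j)` (`E^a × T₀^b × T₁^c × F^d`).  `HC_CM` is NOT asserted. [cite: Markman2025SurveySecant, Thm. 1.2] [cite: Markman2025SecantWeil, Thm 1.5.1]
[cite: Lang2002, VI §1 Thm. 1.1, Cor. 1.6 and V §2 Thm. 2.8] -/
theorem hodgeConjectureFor_biproduct_comp_of_two_sextics_one_decic_of_isEmpty (hW4 : Markman2025_weilClasses_algebraic_abelianFourfold)
    (hM6 : Markman2025_weilClasses_algebraic_hyperbolicSixfold) {N : ℕ} (κ : Fin N → Fin (3 + 1)) (h2 : Module.finrank ℚ (Kf i₀) = 2)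
    (hdeg : ∀ m : Fin 3, Module.finrank ℚ (Kf (is m)) = 2 * ![3, 3, 5] m) (im : ∀ m : Fin 3, Kf i₀ →+* Kf (is m))
    (hA : ∀ j, IsCMTypeRealisation (Φ j) (A j) (ι j) (θ j)) (hΨ : ∀ σ : Kf i₀ →+* ℂ, σ ∈ (Φ 0).1 ↔ σ = τ)
    (hp : ∀ m : Fin 3, (Finset.univ.filter fun s : Kf (is m) →+* ℂ => s.comp (im m) = τ ∧ s ∈ (Φ m.succ).1).card = ![1, 1, 2] m)
    (hK₀₁ : IsEmpty (Kf (is 1) →+* Kf (is 0))) :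
    HodgeConjectureFor (⨁ fun j => A (κ j)).dim (⨁ fun j => A (κ j)).X := by
  have hex : ∀ m : Fin 3, ∃ s : Kf (is m) →+* ℂ, s.comp (im m) = τ := fun m => by
    have hc := SexticOcticWeil.card_filter_comp_eq_of_finrank (n := ![3, 3, 5] m) (im m) (hdeg m) h2 τ
    have hpos : 0 < ![3, 3, 5] m := by fin_cases m <;> decide
    obtain ⟨s, hs⟩ := Finset.card_pos.1 (by rw [hc]; exact hpos)
    exact ⟨s, (Finset.mem_filter.1 hs).2⟩
  choose s₀ hs₀ using hex
  refine hodgeConjectureFor_biproduct_comp_of_sexticsDecics_of_finrank hW4 hM6 (![3, 3, 5]) (![1, 1, 2]) (fun m => by fin_cases m <;> decide) κ h2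
    hdeg im hA hΨ hp fun m₀ hm₀ => ⟨s₀, fun m _ => hs₀ m, ?_⟩
  have h18 : Module.finrank ℚ ↥(adjoin ℚ (Set.range τ) ⊔ adjoin ℚ (Set.range (s₀ 0) ∪ Set.range (s₀ 1))) = 18 := by
    rw [finrank_adjoin_pair_of_isEmpty_ringHom (im 0) (im 1) (by rw [hdeg 0, h2]; decide) (by rw [hdeg 1, h2]; decide) hK₀₁ (hs₀ 0) (hs₀ 1), h2]
  have hU3 : (![3, 3, 5] : Fin 3 → ℕ) m₀ = 3 →
      (⋃ (m : Fin 3) (_ : (![3, 3, 5] : Fin 3 → ℕ) m = ![3, 3, 5] m₀), Set.range (s₀ m)) = Set.range (s₀ 0) ∪ Set.range (s₀ 1) := by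
    intro hm₀
    rw [hm₀]
    ext x
    simp only [Set.mem_iUnion, Set.mem_union, Set.mem_range, exists_prop]
    constructor
    · rintro ⟨m, hm, y, rfl⟩
      fin_cases m
      · exact Or.inl ⟨y, rfl⟩
      · exact Or.inr ⟨y, rfl⟩
      · exact absurd hm (by decide)
    · rintro (⟨y, rfl⟩ | ⟨y, rfl⟩)
      · exact ⟨0, by decide, y, rfl⟩
      · exact ⟨1, by decide, y, rfl⟩
  have hP3 : (![3, 3, 5] : Fin 3 → ℕ) m₀ = 3 →
      2 * (∏ m ∈ Finset.univ.filter (fun m => (![3, 3, 5] : Fin 3 → ℕ) m = ![3, 3, 5] m₀), (![3, 3, 5] : Fin 3 → ℕ) m) = 18 := by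
    intro hm₀
    rw [hm₀]
    decide
  -- the decic class `{2}` is a singleton: the premise of `hD` is empty there
  have hv : (![3, 3, 5] : Fin 3 → ℕ) m₀ = 3 := by
    obtain ⟨m, hne, hn⟩ := hm₀
    fin_cases m₀
    · decide
    · decide
    · exfalso
      fin_cases m
      · exact absurd hn (by decide)
      · exact absurd hn (by decide)
      · exact hne rfl
  rw [hU3 hv, hP3 hv, h18]

/-- **ONE `(1,2)`-THREEFOLD AND TWO `(2,3)`-FIVEFOLDS OVER NON-ISOMORPHIC DECICS, ALL SHARING `k` — given ONLY Markman's two theorems.**  `E = A 0 ⊨ (k; {τ})`;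
`K_0` SEXTIC, `K_1, K_2` DECIC with `Hom(K_2, K_1) = ∅` (degrees `2 · (3, 5, 5)_m`, type counts `(1, 2, 2)_m` over `τ`).  Then the Hodge conjecture holds for EVERY
product of copies `⨁_j A (κ j)` (`E^a × T^b × F₀^c × F₁^d`).  `HC_CM` is NOT asserted. [cite: Markman2025SurveySecant, Thm. 1.2] [cite: Markman2025SecantWeil, Thm 1.5.1]
[cite: Lang2002, VI §1 Thm. 1.1, Cor. 1.6 and V §2 Thm. 2.8] -/
theorem hodgeConjectureFor_biproduct_comp_of_one_sextic_two_decics_of_isEmpty (hW4 : Markman2025_weilClasses_algebraic_abelianFourfold)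
    (hM6 : Markman2025_weilClasses_algebraic_hyperbolicSixfold) {N : ℕ} (κ : Fin N → Fin (3 + 1)) (h2 : Module.finrank ℚ (Kf i₀) = 2)
    (hdeg : ∀ m : Fin 3, Module.finrank ℚ (Kf (is m)) = 2 * ![3, 5, 5] m) (im : ∀ m : Fin 3, Kf i₀ →+* Kf (is m))
    (hA : ∀ j, IsCMTypeRealisation (Φ j) (A j) (ι j) (θ j)) (hΨ : ∀ σ : Kf i₀ →+* ℂ, σ ∈ (Φ 0).1 ↔ σ = τ)
    (hp : ∀ m : Fin 3, (Finset.univ.filter fun s : Kf (is m) →+* ℂ => s.comp (im m) = τ ∧ s ∈ (Φ m.succ).1).card = ![1, 2, 2] m)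
    (hK₁₂ : IsEmpty (Kf (is 2) →+* Kf (is 1))) :
    HodgeConjectureFor (⨁ fun j => A (κ j)).dim (⨁ fun j => A (κ j)).X := by
  have hex : ∀ m : Fin 3, ∃ s : Kf (is m) →+* ℂ, s.comp (im m) = τ := fun m => by
    have hc := SexticOcticWeil.card_filter_comp_eq_of_finrank (n := ![3, 5, 5] m) (im m) (hdeg m) h2 τ
    have hpos : 0 < ![3, 5, 5] m := by fin_cases m <;> decide
    obtain ⟨s, hs⟩ := Finset.card_pos.1 (by rw [hc]; exact hpos)
    exact ⟨s, (Finset.mem_filter.1 hs).2⟩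
  choose s₀ hs₀ using hex
  refine hodgeConjectureFor_biproduct_comp_of_sexticsDecics_of_finrank hW4 hM6 (![3, 5, 5]) (![1, 2, 2]) (fun m => by fin_cases m <;> decide) κ h2
    hdeg im hA hΨ hp fun m₀ hm₀ => ⟨s₀, fun m _ => hs₀ m, ?_⟩
  have h50 : Module.finrank ℚ ↥(adjoin ℚ (Set.range τ) ⊔ adjoin ℚ (Set.range (s₀ 1) ∪ Set.range (s₀ 2))) = 50 := by
    rw [finrank_adjoin_pair_of_isEmpty_ringHom_five (im 1) (im 2) (by rw [hdeg 1, h2]; decide) (by rw [hdeg 2, h2]; decide) hK₁₂ (hs₀ 1) (hs₀ 2), h2]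
  have hU5 : (![3, 5, 5] : Fin 3 → ℕ) m₀ = 5 →
      (⋃ (m : Fin 3) (_ : (![3, 5, 5] : Fin 3 → ℕ) m = ![3, 5, 5] m₀), Set.range (s₀ m)) = Set.range (s₀ 1) ∪ Set.range (s₀ 2) := by
    intro hm₀
    rw [hm₀]
    ext x
    simp only [Set.mem_iUnion, Set.mem_union, Set.mem_range, exists_prop]
    constructor
    · rintro ⟨m, hm, y, rfl⟩
      fin_cases m
      · exact absurd hm (by decide)
      · exact Or.inl ⟨y, rfl⟩
      · exact Or.inr ⟨y, rfl⟩
    · rintro (⟨y, rfl⟩ | ⟨y, rfl⟩)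
      · exact ⟨1, by decide, y, rfl⟩
      · exact ⟨2, by decide, y, rfl⟩
  have hP5 : (![3, 5, 5] : Fin 3 → ℕ) m₀ = 5 →
      2 * (∏ m ∈ Finset.univ.filter (fun m => (![3, 5, 5] : Fin 3 → ℕ) m = ![3, 5, 5] m₀), (![3, 5, 5] : Fin 3 → ℕ) m) = 50 := by
    intro hm₀
    rw [hm₀]
    decide
  -- the sextic class `{0}` is a singleton: the premise of `hD` is empty there
  have hv : (![3, 5, 5] : Fin 3 → ℕ) m₀ = 5 := by
    obtain ⟨m, hne, hn⟩ := hm₀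
    fin_cases m₀
    · exfalso
      fin_cases m
      · exact hne rfl
      · exact absurd hn (by decide)
      · exact absurd hn (by decide)
    · decide
    · decide
  rw [hU5 hv, hP5 hv, h50]

end Summit.HodgeConjecture.CorCM.MultiFieldWeil

end
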